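import Summits.Ventures.PercRepro.S1CFGTriangles

/-!
# PercRepro — THE DENSE TRIANGLE-CLOSED PROPER SUBSET (p1, gen 39; the mechanism of the triangle cap as a theorem)

In a simple (no dependent pair) coloop-free matroid of nullity `ν` on `n ≥ 2ν + 2` points, every rank-`2` triple `T₀` lies
in a PROPER subset `S ⊊ E` which is DENSE — `2·rk S ≤ |S| + 1`, i.e. `|S| ≤ 2·ν(S) + 1` — and TRIANGLE-CLOSED: every rank-`2`
triple meeting `S` lies inside `S` (so every triangle lies in `S` or in `E ∖ S`, `ν(S) ≤ ν − 1`, and `c₃(S) ≤ C(ν(S) + 2, 3)`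
by the landed cap). This is the set `S` of S1CFGTriangles' proof (a maximal set with `ψ = 2·rk − # ≤ 1`), exposed for the
many-triangle regimes of other rows: **`exists_dense_triangle_closed_ssubset`**. Nothing about any cell is claimed. Axioms: standard.
-/

open scoped Matroid

namespace PercRepro

namespace S1CFG

open Set S1CF

variable {α : Type}

/-- **The dense triangle-closed proper subset**: for a rank-`2` triple `T₀` of a simple coloop-free matroid of nullity
`ν` on `n ≥ 2ν + 2` points there is `S` with `T₀ ⊆ S ⊊ E`, `2·rk S ≤ |S| + 1`, and every rank-`2` triple meeting `S`
inside `S`. -/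
theorem exists_dense_triangle_closed_ssubset (M : Matroid α) [M.Finite] {ν : ℕ}
    (hd : M.E.encard = M.eRank + (ν : ℕ∞))
    (h0 : {P : Set α | P ⊆ M.E ∧ P.ncard = 2 ∧ M.Dep P}.ncard = 0) (hn : 2 * ν + 2 ≤ M.E.ncard)
    {T₀ : Set α} (hT₀E : T₀ ⊆ M.E) (hT₀3 : T₀.ncard = 3) (hT₀r : M.eRk T₀ ≤ 2) :
    ∃ S : Set α, T₀ ⊆ S ∧ S ⊆ M.E ∧ S ≠ M.E ∧ 2 * (M.eRk S).toNat ≤ S.ncard + 1 ∧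
      ∀ X, X ⊆ M.E → X.ncard = 3 → M.eRk X ≤ 2 → (S ∩ X).Nonempty → X ⊆ S := by
  classical
  have hEfin := M.ground_finite
  have hnE := ncard_ground_eq_eRk_toNat_add M hd
  set 𝒮 := {S : Set α | S ⊆ M.E ∧ T₀ ⊆ S ∧ 2 * (M.eRk S).toNat ≤ S.ncard + 1} with h𝒮
  have h𝒮fin : 𝒮.Finite := hEfin.finite_subsets.subset (fun S hS => hS.1)
  have hT₀r' : (M.eRk T₀).toNat ≤ 2 := by
    rw [← S1.coe_toNat_eRk M hT₀E] at hT₀r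
    exact_mod_cast hT₀r
  have h𝒮ne : 𝒮.Nonempty := ⟨T₀, hT₀E, subset_refl _, by omega⟩
  obtain ⟨S, ⟨hSE, hT₀S, hψ⟩, hSmax⟩ := h𝒮fin.exists_maximal h𝒮ne
  refine ⟨S, hT₀S, hSE, ?_, hψ, ?_⟩
  · intro hSeq
    rw [hSeq] at hψ
    omega
  · intro X hXE hX3 hXr hSX
    have hmem : S ∪ X ∈ 𝒮 :=
      ⟨union_subset hSE hXE, hT₀S.trans subset_union_left,
        two_mul_eRk_toNat_union_le_of_inter_nonempty M h0 hSE hXE hX3 hXr hSX hψ⟩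
    have hle : S ∪ X ⊆ S := hSmax hmem subset_union_left
    exact subset_union_right.trans hle

/-- The dense set is small: `2·rk S ≤ |S| + 1` reads `|S| ≤ 2·ν(S) + 1` with `ν(S) = |S| − rk S`. -/
theorem ncard_le_two_mul_nullity_add_one (M : Matroid α) [M.Finite] {S : Set α} (hS : S ⊆ M.E)
    (hψ : 2 * (M.eRk S).toNat ≤ S.ncard + 1) : S.ncard ≤ 2 * (S.ncard - (M.eRk S).toNat) + 1 := by
  have hrk : (M.eRk S).toNat ≤ S.ncard := by
    have := M.eRk_le_encard S
    rw [← S1.coe_toNat_eRk M hS, ← (M.ground_finite.subset hS).cast_ncard_eq] at this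
    exact_mod_cast this
  omega

end S1CFG

end PercRepro
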